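import Summits.CriticalPhenomena.PercolationContinuityZ3.Theorems.PercNearOneGluingNoHeavyQuantBudgetNearFlow
import Summits.CriticalPhenomena.PercolationContinuityZ3.Theorems.PercNearOneGluingNoHeavyQuantLightResidDECCriteria
import HarnessLib

/-!
# QUANT lane R8, T-DEC: THE TORQUE-COST CRITERION — the zero atom is free: ANY transport of the positive low atoms (to compatible absorbers,
# at the layer-free rates) whose TORQUE COST `Σ_{h>T} (h − T)·(load of h)` is at most `Σ_{0<l<T} μ(l)(T − l)` extends to a flow at every layer;
# the budget / low-ceiling / near-absorber criteria are its instances, every credit pair and every far pair below `l + (T−l)/y` is cost-safe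
# (arm-1 gen 50, architect)

builds on p205010 (kernel theorem, internal audit signed; external expert review pending)

Support + definition file (`--supports stmt-CriticalPhenomena-4575`), QUANT lane seat prim-quant-arm-1 (gen 50, architect), rung R8 of
`run/shared/lean/prim/quant/LADDER.md`; memo `run/shared/lean/prim/quant/prim-quant-arm-1-g50/ARCH-G50.md` §5.  One small definition (`freeRate`, the
layer-free usage rate written inline in `…QuantBudgetNearFlow`); theorems with standard axioms, no sorries.  Uses the flow normal form `FlowAtT`
(typer g22), `usage_le_kappaNear` (✓ p428891), `usage_zero_mul_le` (`…QuantFlowPieces`), `decAtT_of_flowAtT`, and the light node `LightResidDECAt`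
(✓ p447494) with `capFloor_facts` / `resid_laws_of_two_le` (✓ p447723).

THE CRITERION (ARCH-G50 §5).  Law `A ≥ 0` on `{0..M}`, target `T > 0` (first moment `≥ T·mass`), floor `0 < y < 1`, `y·M ≤ T`.  Give the POSITIVE
low atoms (`1 ≤ l`, `2l < T`) any transport `f ≥ 0` into compatible absorbers (`l < h ≤ M`, `T < l + h`) shipping each exactly and loading every atom by at
most its mass at the LAYER-FREE rate `κ(l,h) = γ/(1−γ)`, `γ = max(y, (T−2l)/(h−l))` (`κ ≥` the per-layer `usage` at every layer, `usage_le_kappaNear`).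
If its TORQUE COST `C = Σ_{h>T} (h−T)·Σ_l κ f` satisfies **`C ≤ Σ_{0<l<T} A(l)(T−l)`** (the positive lows' own torque + the near band's), the torque
identity `Σ_{h>T} A(h)(h−T) ≥ T·A(0) + Σ_{0<l<T} A(l)(T−l)` leaves enough for the zero atom's levers `(0,h;T/h)` (`usage_zero_mul_le`):
`flowAtT_of_torqueCost` (⟹ `FlowAtT` at every layer `j′ < M`), `decAt_all_of_torqueCost`, `lightResidDECAt_of_torqueCost` (the light node).
COST-SAFE ROUTES (`freeRate_torque_le`): `y·(h − l) ≤ T − l` (every credit route automatically — `(h−T)(T−2l) ≤ (T−l)(h+l−T)` is `l(h−l) ≥ 0` — and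
every far route up to `l + (T−l)/y`) gives cost `≤ T − l` per unit; routes into `h ≤ T` cost nothing; hence `flowAtT_of_safeTransport` (no cost
bookkeeping), of which the budget (✓ p423876), low-ceiling / half-top and near-absorber (✓ p428891) criteria are instances.  The object a k-general
proof of `LightResidDEC(Free)` must produce is such a transport of `R_a`'s positive lows; EVIDENCE (ARCH-G50 §2′/§2″): it exists for every one of
≈ 506 000 exact (forest, a) pairs at the capped floor.

HONEST STATUS: certificate infrastructure (sufficient condition); `LightResidDEC`, `ResidDEC`, `SiblingStep`, `FarTreeRow` OPEN; RATE class log\* /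
honest sentence of `run/shared/lean/prim/quant/README.md` unchanged.  [this work]; flow normal form: prim-quant-stmt g22; near rate: arm-1 g49.
Transportation with gains / generalized flows are classical; nothing here is cited as a published result.  The gluing rows served
[cite: KozmaNitzan2024, Conjecture 3 (p. 15)]; product measure [cite: Grimmett1999, §1.3 p. 10].
-/

noncomputable section
open scoped BigOperators
namespace Summit.CriticalPhenomena.PercolationContinuityZ3.Theorems
namespace Quant
namespace LawDec

open Finset

/-! ### The layer-free rate -/

/-- **the layer-free usage rate** of the route `(l, h)` at floor `y`, target `T`: `κ = γ/(1 − γ)` with `γ = max (y, (T − 2l)/(h − l))` — the mass of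
`h` consumed per unit of `l` shipped through the pair `{l, h; γ}` (valid at every layer: giant by `γ ≥ y`, credit by `2l + (h−l)γ ≥ T`). [this work] -/
def freeRate (y T : ℝ) (l h : ℕ) : ℝ :=
  max y ((T - 2 * (l : ℝ)) / ((h : ℝ) - l)) / (1 - max y ((T - 2 * (l : ℝ)) / ((h : ℝ) - l)))

/-- the layer-free rate is nonnegative on compatible routes (`2l < T`, `l < h`, `T < l + h`, `0 < y < 1`). [this work] -/
theorem freeRate_nonneg (y T : ℝ) (l h : ℕ) (hy0 : 0 < y) (hy1 : y < 1) (hlow : 2 * (l : ℝ) < T) (hlh : l < h) (hcomp : T < (l : ℝ) + h) :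
    0 ≤ freeRate y T l h := by
  unfold freeRate
  have hhl : (0 : ℝ) < (h : ℝ) - l := by
    have : (l : ℝ) < h := by exact_mod_cast hlh
    linarith
  have hρ1 : (T - 2 * (l : ℝ)) / ((h : ℝ) - l) < 1 := by rw [div_lt_one hhl]; linarith
  have hγ1 : max y ((T - 2 * (l : ℝ)) / ((h : ℝ) - l)) < 1 := max_lt hy1 hρ1
  exact div_nonneg (le_trans hy0.le (le_max_left _ _)) (by linarith)

/-- **COST-SAFE ROUTES**: for a positive low `l` (`2l < T`), an absorber `h` with `l < h`, `T < l + h` and `y·(h − l) ≤ T − l` (i.e. `h ≤ l + (T−l)/y`;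
every credit route `h − l < (T − 2l)/y` qualifies automatically), the torque cost per unit is at most `T − l`: `freeRate·(h − T) ≤ T − l`.  (Credit case:
`(h−T)(T−2l) ≤ (T−l)(h+l−T)` is `l·(h−l) ≥ 0`; far case: `y(h−T) ≤ (T−l)(1−y)` is the hypothesis.) [this work] -/
theorem freeRate_torque_le (y T : ℝ) (l h : ℕ) (hy0 : 0 < y) (hy1 : y < 1) (hlow : 2 * (l : ℝ) < T) (hlh : l < h) (hcomp : T < (l : ℝ) + h)
    (hsafe : y * ((h : ℝ) - l) ≤ T - l) : freeRate y T l h * ((h : ℝ) - T) ≤ T - l := by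
  unfold freeRate
  have hl0 : (0 : ℝ) ≤ l := Nat.cast_nonneg l
  have hhl : (0 : ℝ) < (h : ℝ) - l := by
    have : (l : ℝ) < h := by exact_mod_cast hlh
    linarith
  set ρ : ℝ := (T - 2 * (l : ℝ)) / ((h : ℝ) - l) with hρ
  have hρ1 : ρ < 1 := by rw [hρ, div_lt_one hhl]; linarith
  have hρdef : ρ * ((h : ℝ) - l) = T - 2 * (l : ℝ) := by rw [hρ, div_mul_cancel₀ _ hhl.ne']
  by_cases hTh : T < (h : ℝ)
  · rcases le_total y ρ with hyρ | hρy
    · rw [max_eq_right hyρ]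
      have h1 : 0 < 1 - ρ := by linarith
      rw [div_mul_eq_mul_div, div_le_iff₀ h1]
      nlinarith [mul_nonneg hl0 hhl.le]
    · rw [max_eq_left hρy]
      have h1 : 0 < 1 - y := by linarith
      rw [div_mul_eq_mul_div, div_le_iff₀ h1]
      nlinarith
  · -- `h ≤ T`: the cost is nonpositive
    have hκ := freeRate_nonneg y T l h hy0 hy1 hlow hlh hcomp
    unfold freeRate at hκ
    have : max y ρ / (1 - max y ρ) * ((h : ℝ) - T) ≤ 0 := mul_nonpos_of_nonneg_of_nonpos hκ (by linarith)
    linarith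

/-! ### The torque-cost criterion -/

/-- **THE TORQUE-COST CRITERION (flow form).**  `A ≥ 0` on `{0..M}`, target `T > 0` with first moment `≥ T·mass`, floor `0 < y < 1`, `y·M ≤ T`; a
transport `f ≥ 0` of the positive low atoms (support: `1 ≤ l`, `2l < T`, `l < h ≤ M`, `T < l + h`; rows `Σ_h f(l,h) = A(l)`; loads `Σ_l κ(l,h) f(l,h) ≤ A(h)`
at the layer-free rate `κ = freeRate`) whose torque cost `Σ_{h>T} (h−T)·Σ_l κ f` is at most `Σ_{1 ≤ l < T} A(l)(T − l)`.  Then `FlowAtT y T j′ M A` at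
every layer `j′ < M`: the positive lows keep their routes (valid at every layer), the zero atom ships by levers on the torque that is left
(`≥ T·A(0)` by the torque identity). [this work] -/
theorem flowAtT_of_torqueCost (y T : ℝ) (j' M : ℕ) (A : ℕ → ℝ) (f : ℕ → ℕ → ℝ) (hy0 : 0 < y) (hy1 : y < 1) (hT : 0 < T) (hj : j' < M)
    (hA0 : ∀ h, 0 ≤ A h) (hAM : ∀ h, M < h → A h = 0) (hta : y * (M : ℝ) ≤ T)
    (hmom : T * ∑ h ∈ Finset.range (M + 1), A h ≤ ∑ h ∈ Finset.range (M + 1), (h : ℝ) * A h)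
    (hf0 : ∀ l h, 0 ≤ f l h)
    (hfs : ∀ l h, 0 < f l h → 1 ≤ l ∧ 2 * (l : ℝ) < T ∧ l < h ∧ h ≤ M ∧ T < (l : ℝ) + h)
    (hrow : ∀ l : ℕ, 1 ≤ l → 2 * (l : ℝ) < T → ∑ h ∈ Finset.range (M + 1), f l h = A l)
    (hcap : ∀ h, h ≤ M → ∑ l ∈ Finset.range (M + 1), freeRate y T l h * f l h ≤ A h)
    (hcost : ∑ h ∈ Finset.range (M + 1), (if T < (h : ℝ) then ((h : ℝ) - T) * ∑ l ∈ Finset.range (M + 1), freeRate y T l h * f l h else 0)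
      ≤ ∑ l ∈ Finset.range (M + 1), (if (1 ≤ l ∧ (l : ℝ) < T) then A l * (T - l) else 0)) :
    FlowAtT y T j' M A := by
  classical
  set K : ℕ → ℝ := fun h => ∑ l ∈ Finset.range (M + 1), freeRate y T l h * f l h with hK
  set wL : ℕ → ℝ := fun l => if (1 ≤ l ∧ (l : ℝ) < T) then A l * (T - l) else 0 with hwL
  set β : ℕ → ℝ := fun h => if T < (h : ℝ) then A h * ((h : ℝ) - T) else 0 with hβ
  set c : ℕ → ℝ := fun h => if T < (h : ℝ) then ((h : ℝ) - T) * K h else 0 with hc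
  set W : ℝ := ∑ l ∈ Finset.range (M + 1), wL l with hW
  set B : ℝ := ∑ h ∈ Finset.range (M + 1), β h with hB
  set C : ℝ := ∑ h ∈ Finset.range (M + 1), c h with hC
  have hKf0 : ∀ l h, 0 ≤ freeRate y T l h * f l h := by
    intro l h
    rcases (hf0 l h).eq_or_lt with hz | hpos
    · rw [← hz, mul_zero]
    · obtain ⟨_, hlow, hlh, _, hcomp⟩ := hfs l h hpos
      exact mul_nonneg (freeRate_nonneg y T l h hy0 hy1 hlow hlh hcomp) (hf0 l h)
  have hK0 : ∀ h, 0 ≤ K h := fun h => Finset.sum_nonneg fun l _ => hKf0 l h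
  have hKA : ∀ h, K h ≤ A h := by
    intro h
    by_cases hhM : h ≤ M
    · exact hcap h hhM
    · have hz : K h = 0 := Finset.sum_eq_zero fun l _ => by
        rcases (hf0 l h).eq_or_lt with hz | hpos
        · rw [← hz, mul_zero]
        · exact absurd (hfs l h hpos).2.2.2.1 hhM
      rw [hz]; exact hA0 h
  have hwL0 : ∀ l, 0 ≤ wL l := fun l => by
    simp only [hwL]; split_ifs with hcnd
    · exact mul_nonneg (hA0 l) (by linarith [hcnd.2])
    · exact le_rfl
  have hβM : ∀ h, M < h → β h = 0 := fun h hh => by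
    simp only [hβ]; split_ifs
    · rw [hAM h hh, zero_mul]
    · rfl
  have hrem0 : ∀ h, 0 ≤ β h - c h := fun h => by
    simp only [hβ, hc]
    by_cases hTh : T < (h : ℝ)
    · rw [if_pos hTh, if_pos hTh]
      have := mul_le_mul_of_nonneg_left (hKA h) (show (0 : ℝ) ≤ (h : ℝ) - T by linarith)
      nlinarith
    · rw [if_neg hTh, if_neg hTh, sub_zero]
  have hcβ : ∀ h, c h ≤ β h := fun h => by linarith [hrem0 h]
  have hBge : T * A 0 + W ≤ B := by
    have hpt : ∀ h ∈ Finset.range (M + 1),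
        ((h : ℝ) - T) * A h ≤ β h - wL h - (if h = 0 then T * A h else 0) := by
      intro h _
      have hh0 : (0 : ℝ) ≤ h := Nat.cast_nonneg h
      have hAh := hA0 h
      simp only [hβ, hwL]
      by_cases hTh : T < (h : ℝ)
      · have h1 : ¬ (1 ≤ h ∧ (h : ℝ) < T) := fun hcnd => by linarith [hcnd.2]
        have h0 : h ≠ 0 := by rintro rfl; simp only [Nat.cast_zero] at hTh; linarith
        rw [if_pos hTh, if_neg h1, if_neg h0]; linarith
      · rw [if_neg hTh]
        by_cases h0 : h = 0
        · subst h0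
          have h1 : ¬ (1 ≤ 0 ∧ ((0 : ℕ) : ℝ) < T) := fun hcnd => by omega
          rw [if_neg h1, if_pos rfl]; simp only [Nat.cast_zero]; nlinarith
        · rw [if_neg h0]
          by_cases h1 : (1 ≤ h ∧ (h : ℝ) < T)
          · rw [if_pos h1]; nlinarith
          · rw [if_neg h1]
            have hhT : (h : ℝ) = T := by
              have h1' : 1 ≤ h := Nat.one_le_iff_ne_zero.2 h0
              have : ¬ ((h : ℝ) < T) := fun hlt => h1 ⟨h1', hlt⟩
              linarith [not_lt.1 this, not_lt.1 hTh]
            rw [hhT]; nlinarith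
    have hsum := Finset.sum_le_sum hpt
    rw [Finset.sum_sub_distrib, Finset.sum_sub_distrib, Finset.sum_ite_eq' (Finset.range (M + 1)) 0,
      if_pos (Finset.mem_range.2 (Nat.succ_pos M))] at hsum
    have e : ∑ h ∈ Finset.range (M + 1), ((h : ℝ) - T) * A h
        = ∑ h ∈ Finset.range (M + 1), (h : ℝ) * A h - T * ∑ h ∈ Finset.range (M + 1), A h := by
      rw [Finset.mul_sum, ← Finset.sum_sub_distrib]
      exact Finset.sum_congr rfl fun h _ => by ring
    rw [e] at hsum
    linarith
  have hCW : C ≤ W := hcost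
  set R : ℝ := B - C with hR
  have hremsum : ∑ h ∈ Finset.range (M + 1), (β h - c h) = R := by rw [Finset.sum_sub_distrib]
  have hRge : T * A 0 ≤ R := by rw [hR]; linarith
  have hR0 : 0 ≤ R := le_trans (mul_nonneg hT.le (hA0 0)) hRge
  refine ⟨fun l h => (if (1 ≤ l ∧ l ≤ j' ∧ 2 * (l : ℝ) < T) then f l h else 0)
      + (if l = 0 then A 0 * (β h - c h) / R else 0),
    fun l h => ?_, fun l h hp => ?_, fun l hl hlow => ?_, fun h hhM habs => ?_⟩
  · -- nonnegativity
    refine add_nonneg ?_ ?_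
    · split_ifs
      · exact hf0 l h
      · exact le_rfl
    · split_ifs
      · exact div_nonneg (mul_nonneg (hA0 0) (hrem0 h)) hR0
      · exact le_rfl
  · -- support
    dsimp only at hp
    by_cases hl0 : l = 0
    · subst hl0
      have h1 : ¬ (1 ≤ 0 ∧ 0 ≤ j' ∧ 2 * ((0 : ℕ) : ℝ) < T) := fun hcnd => by omega
      rw [if_neg h1, if_pos rfl, zero_add] at hp
      have hrem : 0 < β 0 - c 0 ∨ 0 < β h - c h := Or.inr (by
        by_contra hn
        have hz : β h - c h = 0 := le_antisymm (not_lt.1 hn) (hrem0 h)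
        rw [hz, mul_zero, zero_div] at hp
        exact lt_irrefl _ hp)
      have hβpos : T < (h : ℝ) ∧ h ≤ M := by
        rcases hrem with hx | hx
        · exfalso
          simp only [hβ, hc] at hx
          have : ¬ (T < ((0 : ℕ) : ℝ)) := by simp only [Nat.cast_zero]; linarith
          rw [if_neg this, if_neg this, sub_zero] at hx
          exact lt_irrefl _ hx
        · have hβh : 0 < β h := lt_of_lt_of_le hx (by linarith [hcβ h, hK0 h, (show 0 ≤ c h by
              simp only [hc]; split_ifs with hTh
              · exact mul_nonneg (by linarith) (hK0 h)
              · exact le_rfl)])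
          have hTh : T < (h : ℝ) := by
            by_contra hn; simp only [hβ, if_neg hn] at hβh; exact lt_irrefl _ hβh
          refine ⟨hTh, ?_⟩
          by_contra hn
          have := hβM h (not_le.1 hn)
          rw [this] at hβh; exact lt_irrefl _ hβh
      exact ⟨Nat.zero_le _, by simpa using hT, hβpos.2, Or.inr (by simpa using hβpos.1)⟩
    · rw [if_neg hl0, add_zero] at hp
      have hcnd : 1 ≤ l ∧ l ≤ j' ∧ 2 * (l : ℝ) < T := by
        by_contra hn; rw [if_neg hn] at hp; exact lt_irrefl _ hp
      rw [if_pos hcnd] at hp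
      obtain ⟨_, _, _, hhM, hcomp⟩ := hfs l h hp
      exact ⟨hcnd.2.1, hcnd.2.2, hhM, Or.inr hcomp⟩
  · -- rows
    dsimp only
    by_cases hl0 : l = 0
    · subst hl0
      have e : ∀ h ∈ Finset.range (M + 1),
          ((if (1 ≤ 0 ∧ 0 ≤ j' ∧ 2 * ((0 : ℕ) : ℝ) < T) then f 0 h else 0)
            + (if (0 : ℕ) = 0 then A 0 * (β h - c h) / R else 0)) = A 0 * (β h - c h) / R := by
        intro h _
        rw [if_neg (fun hcnd => by omega), if_pos rfl, zero_add]
      rw [Finset.sum_congr rfl e, ← Finset.sum_div, ← Finset.mul_sum, hremsum]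
      rcases hR0.eq_or_lt with hz | hpos
      · have hA00 : A 0 = 0 := le_antisymm (by nlinarith [hRge, hz.symm]) (hA0 0)
        rw [hA00, zero_mul, zero_div]
      · rw [mul_div_assoc, div_self hpos.ne', mul_one]
    · have hl1 : 1 ≤ l := Nat.one_le_iff_ne_zero.2 hl0
      have e : ∀ h ∈ Finset.range (M + 1),
          ((if (1 ≤ l ∧ l ≤ j' ∧ 2 * (l : ℝ) < T) then f l h else 0)
            + (if l = 0 then A 0 * (β h - c h) / R else 0)) = f l h := by
        intro h _
        rw [if_pos ⟨hl1, hl, hlow⟩, if_neg hl0, add_zero]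
      rw [Finset.sum_congr rfl e]
      exact hrow l hl1 hlow
  · -- loads
    dsimp only
    have hyh : y * (h : ℝ) ≤ T := le_trans (mul_le_mul_of_nonneg_left (by exact_mod_cast hhM) hy0.le) hta
    have hlows : ∑ l ∈ Finset.range (j' + 1),
        usage y T j' l h * (if (1 ≤ l ∧ l ≤ j' ∧ 2 * (l : ℝ) < T) then f l h else 0) ≤ K h := by
      have hpt : ∀ l ∈ Finset.range (j' + 1),
          usage y T j' l h * (if (1 ≤ l ∧ l ≤ j' ∧ 2 * (l : ℝ) < T) then f l h else 0) ≤ freeRate y T l h * f l h := by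
        intro l _
        by_cases hcnd : 1 ≤ l ∧ l ≤ j' ∧ 2 * (l : ℝ) < T
        · rw [if_pos hcnd]
          rcases (hf0 l h).eq_or_lt with hz | hpos
          · rw [← hz, mul_zero, mul_zero]
          · obtain ⟨_, hlow, hlh, _, hcomp⟩ := hfs l h hpos
            exact mul_le_mul_of_nonneg_right (usage_le_kappaNear y T j' l h hy0 hy1 hlow hlh hcomp) (hf0 l h)
        · rw [if_neg hcnd, mul_zero]; exact hKf0 l h
      refine (Finset.sum_le_sum hpt).trans ?_
      exact Finset.sum_le_sum_of_subset_of_nonneg (Finset.range_mono (by omega)) (fun l _ _ => hKf0 l h)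
    have hzero : ∑ l ∈ Finset.range (j' + 1),
        usage y T j' l h * (if l = 0 then A 0 * (β h - c h) / R else 0) ≤ A h - K h := by
      rw [Finset.sum_eq_single 0 (fun l _ hl => by rw [if_neg hl, mul_zero])
        (fun hn => absurd (Finset.mem_range.2 (Nat.succ_pos j')) hn), if_pos rfl]
      by_cases hTh : T < (h : ℝ)
      · have hhT : 0 < (h : ℝ) - T := by linarith
        have hu := usage_zero_mul_le y T j' h hy0 hy1 hT (Or.inr hTh) hyh
        have hremh : β h - c h = ((h : ℝ) - T) * (A h - K h) := by
          simp only [hβ, hc, if_pos hTh]; ring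
        have h2 : 0 ≤ A h - K h := by linarith [hKA h]
        rcases hR0.eq_or_lt with hz | hRpos
        · have hA00 : A 0 = 0 := le_antisymm (by nlinarith [hRge, hz.symm]) (hA0 0)
          rw [hA00, zero_mul, zero_div, mul_zero]; exact h2
        · have e1 : usage y T j' 0 h * (A 0 * (β h - c h) / R)
              = usage y T j' 0 h * ((h : ℝ) - T) * (A 0 / R) * (A h - K h) := by
            rw [hremh]; field_simp
          rw [e1]
          have h1 : usage y T j' 0 h * ((h : ℝ) - T) * (A 0 / R) ≤ 1 := by
            calc usage y T j' 0 h * ((h : ℝ) - T) * (A 0 / R) ≤ T * (A 0 / R) :=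
                  mul_le_mul_of_nonneg_right hu (div_nonneg (hA0 0) hR0)
              _ = T * A 0 / R := by ring
              _ ≤ 1 := (div_le_one hRpos).2 hRge
          calc usage y T j' 0 h * ((h : ℝ) - T) * (A 0 / R) * (A h - K h)
              ≤ 1 * (A h - K h) := mul_le_mul_of_nonneg_right h1 h2
            _ = A h - K h := one_mul _
      · have hz : β h - c h = 0 := by simp only [hβ, hc, if_neg hTh, sub_zero]
        rw [hz, mul_zero, zero_div, mul_zero]
        linarith [hKA h]
    have e : ∀ l, usage y T j' l h * ((if (1 ≤ l ∧ l ≤ j' ∧ 2 * (l : ℝ) < T) then f l h else 0)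
          + (if l = 0 then A 0 * (β h - c h) / R else 0))
        = usage y T j' l h * (if (1 ≤ l ∧ l ≤ j' ∧ 2 * (l : ℝ) < T) then f l h else 0)
          + usage y T j' l h * (if l = 0 then A 0 * (β h - c h) / R else 0) := fun l => by ring
    rw [Finset.sum_congr rfl fun l _ => e l, Finset.sum_add_distrib]
    linarith [add_le_add hlows hzero]

/-- **THE TORQUE-COST CRITERION AT THE MEAN ⟹ DEC AT EVERY LAYER.** [this work] -/
theorem decAt_all_of_torqueCost (y : ℝ) (M : ℕ) (μ : ℕ → ℝ) (T : ℝ) (f : ℕ → ℕ → ℝ) (hy0 : 0 < y) (hy1 : y < 1)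
    (hμ0 : ∀ h, 0 ≤ μ h) (hμM : ∀ h, M < h → μ h = 0) (hμ1 : ∑ h ∈ Finset.range (M + 1), μ h = 1)
    (hT : ∑ h ∈ Finset.range (M + 1), (h : ℝ) * μ h = T) (hT0 : 0 < T) (hta : y * (M : ℝ) ≤ T)
    (hf0 : ∀ l h, 0 ≤ f l h)
    (hfs : ∀ l h, 0 < f l h → 1 ≤ l ∧ 2 * (l : ℝ) < T ∧ l < h ∧ h ≤ M ∧ T < (l : ℝ) + h)
    (hrow : ∀ l : ℕ, 1 ≤ l → 2 * (l : ℝ) < T → ∑ h ∈ Finset.range (M + 1), f l h = μ l)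
    (hcap : ∀ h, h ≤ M → ∑ l ∈ Finset.range (M + 1), freeRate y T l h * f l h ≤ μ h)
    (hcost : ∑ h ∈ Finset.range (M + 1), (if T < (h : ℝ) then ((h : ℝ) - T) * ∑ l ∈ Finset.range (M + 1), freeRate y T l h * f l h else 0)
      ≤ ∑ l ∈ Finset.range (M + 1), (if (1 ≤ l ∧ (l : ℝ) < T) then μ l * (T - l) else 0)) :
    ∀ j', j' < M → DECAt y j' M μ := by
  intro j' hj'
  have hmom : T * ∑ h ∈ Finset.range (M + 1), μ h ≤ ∑ h ∈ Finset.range (M + 1), (h : ℝ) * μ h := by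
    rw [hμ1, hT, mul_one]
  rw [decAt_iff_decAtT, hT]
  exact decAtT_of_flowAtT y T j' M μ hy0 hy1 hμM hμ1
    (flowAtT_of_torqueCost y T j' M μ f hy0 hy1 hT0 hj' hμ0 hμM hta hmom hf0 hfs hrow hcap hcost)

/-- **A COST-SAFE TRANSPORT NEEDS NO COST BOOKKEEPING**: if every route used is cost-safe (`y·(h − l) ≤ T − l`, which includes every route into
`h ≤ T` and every credit route), the torque-cost hypothesis holds automatically (route by route `κ·(h−T) ≤ T − l`, `freeRate_torque_le`). [this work] -/
theorem flowAtT_of_safeTransport (y T : ℝ) (j' M : ℕ) (A : ℕ → ℝ) (f : ℕ → ℕ → ℝ) (hy0 : 0 < y) (hy1 : y < 1) (hT : 0 < T) (hj : j' < M)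
    (hA0 : ∀ h, 0 ≤ A h) (hAM : ∀ h, M < h → A h = 0) (hta : y * (M : ℝ) ≤ T)
    (hmom : T * ∑ h ∈ Finset.range (M + 1), A h ≤ ∑ h ∈ Finset.range (M + 1), (h : ℝ) * A h)
    (hf0 : ∀ l h, 0 ≤ f l h)
    (hfs : ∀ l h, 0 < f l h → 1 ≤ l ∧ 2 * (l : ℝ) < T ∧ l < h ∧ h ≤ M ∧ T < (l : ℝ) + h ∧ y * ((h : ℝ) - l) ≤ T - l)
    (hrow : ∀ l : ℕ, 1 ≤ l → 2 * (l : ℝ) < T → ∑ h ∈ Finset.range (M + 1), f l h = A l)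
    (hcap : ∀ h, h ≤ M → ∑ l ∈ Finset.range (M + 1), freeRate y T l h * f l h ≤ A h) :
    FlowAtT y T j' M A := by
  classical
  refine flowAtT_of_torqueCost y T j' M A f hy0 hy1 hT hj hA0 hAM hta hmom hf0
    (fun l h hp => ⟨(hfs l h hp).1, (hfs l h hp).2.1, (hfs l h hp).2.2.1, (hfs l h hp).2.2.2.1, (hfs l h hp).2.2.2.2.1⟩)
    hrow hcap ?_
  have hterm : ∀ h ∈ Finset.range (M + 1),
      (if T < (h : ℝ) then ((h : ℝ) - T) * ∑ l ∈ Finset.range (M + 1), freeRate y T l h * f l h else 0)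
        ≤ ∑ l ∈ Finset.range (M + 1), (if (1 ≤ l ∧ 2 * (l : ℝ) < T) then (T - l) * f l h else 0) := by
    intro h _
    have hrhs0 : 0 ≤ ∑ l ∈ Finset.range (M + 1), (if (1 ≤ l ∧ 2 * (l : ℝ) < T) then (T - l) * f l h else 0) :=
      Finset.sum_nonneg fun l _ => by
        split_ifs with hcnd
        · exact mul_nonneg (by linarith [hcnd.2, (Nat.cast_nonneg l : (0 : ℝ) ≤ l)]) (hf0 l h)
        · exact le_rfl
    by_cases hTh : T < (h : ℝ)
    · rw [if_pos hTh, Finset.mul_sum]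
      refine Finset.sum_le_sum fun l _ => ?_
      rcases (hf0 l h).eq_or_lt with hz | hpos
      · rw [← hz, mul_zero, mul_zero]
        split_ifs
        · rw [mul_zero]
        · exact le_rfl
      · obtain ⟨hl1, hlow, hlh, _, hcomp, hsafe⟩ := hfs l h hpos
        rw [if_pos ⟨hl1, hlow⟩]
        calc ((h : ℝ) - T) * (freeRate y T l h * f l h) = (freeRate y T l h * ((h : ℝ) - T)) * f l h := by ring
          _ ≤ (T - l) * f l h :=
            mul_le_mul_of_nonneg_right (freeRate_torque_le y T l h hy0 hy1 hlow hlh hcomp hsafe) (hf0 l h)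
    · rw [if_neg hTh]; exact hrhs0
  refine (Finset.sum_le_sum hterm).trans ?_
  rw [Finset.sum_comm]
  refine Finset.sum_le_sum fun l _ => ?_
  by_cases hcnd : 1 ≤ l ∧ 2 * (l : ℝ) < T
  · simp only [if_pos hcnd]
    have hlT : (l : ℝ) < T := by linarith [hcnd.2, (Nat.cast_nonneg l : (0 : ℝ) ≤ l)]
    rw [if_pos ⟨hcnd.1, hlT⟩, ← Finset.mul_sum, hrow l hcnd.1 hcnd.2, mul_comm]
  · simp only [if_neg hcnd, Finset.sum_const_zero]
    split_ifs with h2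
    · exact mul_nonneg (hA0 l) (by linarith [h2.2])
    · exact le_rfl

/-! ### The light node from a transport -/

/-- **`LightResidDECAt` FROM THE TORQUE-COST CRITERION.**  Tree-built siblings (at least two) at floor `0 < x < 1`, `0 < a < 1`, `y = min (a·x) (1/2)`,
`T = a·fmean L`, `R = resid a (wco a L) L`: any transport of `R`'s positive low atoms at the layer-free rates with torque cost at most
`Σ_{1 ≤ l < T} R(l)(T − l)` gives the light node at gate `a`. [this work] -/
theorem lightResidDECAt_of_torqueCost {x a : ℝ} (hx0 : 0 < x) (hx1 : x < 1) (ha0 : 0 < a) (ha1 : a < 1) (L : List Sib)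
    (hL : ∀ s ∈ L, s.TreeOK x) (hk : 2 ≤ L.length) (f : ℕ → ℕ → ℝ) (hf0 : ∀ l h, 0 ≤ f l h)
    (hfs : ∀ l h, 0 < f l h → 1 ≤ l ∧ 2 * (l : ℝ) < a * fmean L ∧ l < h ∧ h ≤ ftop L ∧ a * fmean L < (l : ℝ) + h)
    (hrow : ∀ l : ℕ, 1 ≤ l → 2 * (l : ℝ) < a * fmean L → ∑ h ∈ Finset.range (ftop L + 1), f l h = resid a (wco a L) L l)
    (hcap : ∀ h, h ≤ ftop L →
      ∑ l ∈ Finset.range (ftop L + 1), freeRate (min (a * x) (1 / 2)) (a * fmean L) l h * f l h ≤ resid a (wco a L) L h)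
    (hcost : ∑ h ∈ Finset.range (ftop L + 1), (if a * fmean L < (h : ℝ) then
        ((h : ℝ) - a * fmean L) * ∑ l ∈ Finset.range (ftop L + 1), freeRate (min (a * x) (1 / 2)) (a * fmean L) l h * f l h else 0)
      ≤ ∑ l ∈ Finset.range (ftop L + 1), (if (1 ≤ l ∧ (l : ℝ) < a * fmean L) then resid a (wco a L) L l * (a * fmean L - l) else 0)) :
    LightResidDECAt x a L := by
  obtain ⟨hy0, _, _, hy1, hta⟩ := capFloor_facts hx0 hx1 ha0 L hL
  obtain ⟨r0, rM, r1, rmn, hT0⟩ := resid_laws_of_two_le ha0 ha1 L hL hk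
  exact decAt_all_of_torqueCost (min (a * x) (1 / 2)) (ftop L) (resid a (wco a L) L) (a * fmean L) f hy0 hy1 r0 rM r1 rmn hT0 hta hf0
    hfs hrow hcap hcost

end LawDec
end Quant
end Summit.CriticalPhenomena.PercolationContinuityZ3.Theorems
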